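import Mathlib

/-!
# Crux `DivisionGap.PerCofactorDegreeReduction` (stmt-ValiantsHypothesis-15046), line `Sketch` —
# stub `stub_weightedLineNormalForm`: normal form of a polynomial supported on one weighted line

**Theorem (`stub_weightedLineNormalForm`).** Let `K` be a commutative semiring, `e, e' ≥ 1`, and
let `R ≠ 0` in `K[z₀, z₁]` be weighted homogeneous of weighted degree `D` for the weights
`(e, e')`, i.e. every monomial `z₀^a z₁^b` of `R` satisfies `a e + b e' = D`.  Put
`g = gcd(e, e')`, `p = e' / g`, `q = e / g`.  Then
`R = z₀^{a₀} z₁^{b₀} · Σ_{i=0}^{N} c_i (z₀^p)^i (z₁^q)^{N-i}` for some `a₀, b₀, N` and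
coefficients `c_i ∈ K` with `c₀ ≠ 0`: a monomial times a binary form in `z₀^p, z₁^q`.

## Proof

Pure combinatorics of the support `S` of `R` (nonempty as `R ≠ 0`).  Every `m ∈ S` satisfies
`m₀ e + m₁ e' = D`, hence (cancelling `g`) any two `m, m' ∈ S` satisfy
`m₀ q + m₁ p = m'₀ q + m'₁ p`.
* *Line step* (`line_step`).  If `a q + b p = a' q + b' p` with `a ≤ a'`, `gcd(q, p) = 1` and
  `p > 0`, then `a' = a + k p` and `b = b' + k q` for some `k`: indeed `(b - b') p = (a' - a) q`,
  so `p ∣ a' - a` by coprimality, and cancelling `p` gives the second identity.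
* Let `m_min ∈ S` minimise and `m_max ∈ S` maximise the first exponent; put `a₀ = (m_min)₀`,
  `b₀ = (m_max)₁`.  The line step for `(m_min, m_max)` gives `N` with `(m_max)₀ = a₀ + N p`,
  `(m_min)₁ = b₀ + N q`.  For a general `m ∈ S` the line steps for `(m_min, m)` and `(m, m_max)`
  give `k, j` with `m₀ = a₀ + k p`, `(m_max)₀ = m₀ + j p`, `m₁ = b₀ + j q`; comparing,
  `N = k + j`, so `m = (a₀ + k p, b₀ + (N - k) q)` with `k ≤ N` (`claim`).
* Put `c_k := coeff_{(a₀ + k p, b₀ + (N - k) q)} R`.  Then `c₀ = coeff_{m_min} R ≠ 0`, and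
  expanding the right-hand side into the monomials `(a₀ + k p, b₀ + (N - k) q)` (pairwise distinct
  as `p > 0`) and comparing coefficients with `R` (whose support consists of such exponents only,
  by the claim) proves the identity.
-/

noncomputable section

-- `Summit.ValiantsHypothesis.ValiantsHypothesis.…` is the tree's mandated single-conjunct layout
-- (Problem = Summit), so the duplicated namespace component is intended.
set_option linter.dupNamespace false

namespace Summit.ValiantsHypothesis.ValiantsHypothesis.Theorems.DivisionGap.PerCofactorDegreeReduction.WeightedLineNormalForm

open MvPolynomial
open scoped BigOperators

/-- **Line step.** On the line `a q + b p = const` with `gcd(q, p) = 1` and `p > 0`, moving from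
first coordinate `a` to a larger first coordinate `a'` is a whole number `k` of steps `(+p, -q)`:
`a' = a + k p` and `b = b' + k q`. [folklore] -/
theorem line_step {a b a' b' p q : ℕ} (hcop : Nat.Coprime q p) (hp : 0 < p)
    (h : a * q + b * p = a' * q + b' * p) (hle : a ≤ a') :
    ∃ k, a' = a + k * p ∧ b = b' + k * q := by
  obtain ⟨d, rfl⟩ := Nat.exists_eq_add_of_le hle
  have h1 : b * p = d * q + b' * p := by linarith
  have hb : b' ≤ b := Nat.le_of_mul_le_mul_right (by rw [h1]; exact Nat.le_add_left _ _) hp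
  have h2 : (b - b') * p = d * q := by
    rw [Nat.sub_mul]
    omega
  have hdvd : p ∣ d := by
    refine (Nat.Coprime.dvd_of_dvd_mul_right hcop.symm) ?_
    exact ⟨b - b', by rw [← h2, Nat.mul_comm]⟩
  obtain ⟨k, rfl⟩ := hdvd
  refine ⟨k, by ring, ?_⟩
  have h3 : (b - b') * p = (k * q) * p := by rw [h2]; ring
  have h4 : b - b' = k * q := Nat.eq_of_mul_eq_mul_right hp h3
  omega

/-- **Weighted line normal form.** A nonzero polynomial in two variables which is weighted
homogeneous for the weights `(e, e')`, `e, e' ≥ 1`, is a monomial `z₀^{a₀} z₁^{b₀}` times a binary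
form `Σ_{i ≤ N} c_i (z₀^p)^i (z₁^q)^{N-i}` in the powers `z₀^p`, `z₁^q`, `p = e'/gcd(e,e')`,
`q = e/gcd(e,e')`, with `c₀ ≠ 0`. [folklore] -/
theorem stub_weightedLineNormalForm {K : Type} [CommSemiring K] (e e' D : ℕ)
    (he : 1 ≤ e) (he' : 1 ≤ e')
    (R : MvPolynomial (Fin 2) K) (hR : R ≠ 0)
    (hw : MvPolynomial.IsWeightedHomogeneous (![e, e'] : Fin 2 → ℕ) R D) :
    ∃ (a₀ b₀ N : ℕ) (c : Fin (N + 1) → K), c 0 ≠ 0 ∧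
      R = X 0 ^ a₀ * X 1 ^ b₀ *
        ∑ i : Fin (N + 1), C (c i) *
          ((X 0 ^ (e' / Nat.gcd e e')) ^ (i : ℕ) * (X 1 ^ (e / Nat.gcd e e')) ^ (N - (i : ℕ))) := by
  classical
  -- §0 Arithmetic of the weights.
  set g := Nat.gcd e e' with hg_def
  set p := e' / g with hp_def
  set q := e / g with hq_def
  have hg : 0 < g := Nat.gcd_pos_of_pos_left e' he
  have hep : e' = p * g := (Nat.div_mul_cancel (Nat.gcd_dvd_right e e')).symm
  have heq : e = q * g := (Nat.div_mul_cancel (Nat.gcd_dvd_left e e')).symm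
  have hcop : Nat.Coprime q p := Nat.coprime_div_gcd_div_gcd hg
  have hp : 0 < p := Nat.div_pos (Nat.le_of_dvd he' (Nat.gcd_dvd_right e e')) hg
  -- §1 The support lies on the line `m₀ q + m₁ p = const`.
  have hwt : ∀ m ∈ R.support, m 0 * e + m 1 * e' = D := by
    intro m hm
    have := hw (mem_support_iff.mp hm)
    simpa [Finsupp.weight_apply, Finsupp.sum_fintype, Fin.sum_univ_two] using this
  have hline : ∀ m ∈ R.support, ∀ m' ∈ R.support,
      m 0 * q + m 1 * p = m' 0 * q + m' 1 * p := by
    intro m hm m' hm'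
    apply Nat.eq_of_mul_eq_mul_right hg
    have h1 := hwt m hm
    have h2 := hwt m' hm'
    rw [hep, heq] at h1 h2
    calc (m 0 * q + m 1 * p) * g = m 0 * (q * g) + m 1 * (p * g) := by ring
      _ = m' 0 * (q * g) + m' 1 * (p * g) := by rw [h1, h2]
      _ = (m' 0 * q + m' 1 * p) * g := by ring
  -- §2 Extremal points of the support and the parameter `N`.
  have hS : R.support.Nonempty := support_nonempty.mpr hR
  obtain ⟨mmin, hmin, hminle⟩ := R.support.exists_min_image (fun m => m 0) hS
  obtain ⟨mmax, hmax, hmaxle⟩ := R.support.exists_max_image (fun m => m 0) hS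
  obtain ⟨N, hN0, hN1⟩ := line_step hcop hp (hline _ hmin _ hmax) (hminle _ hmax)
  -- §3 Every support point is `(a₀ + k p, b₀ + (N - k) q)` with `k ≤ N`.
  have claim : ∀ m ∈ R.support, ∃ k ≤ N,
      m 0 = mmin 0 + k * p ∧ m 1 = mmax 1 + (N - k) * q := by
    intro m hm
    obtain ⟨k, hk0, -⟩ := line_step hcop hp (hline _ hmin _ hm) (hminle _ hm)
    obtain ⟨j, hj0, hj1⟩ := line_step hcop hp (hline _ hm _ hmax) (hmaxle _ hm)
    have hNkj : N = k + j := by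
      apply Nat.eq_of_mul_eq_mul_right hp
      have := hN0
      rw [hj0, hk0] at this
      linarith
    refine ⟨k, by omega, hk0, ?_⟩
    rw [hj1, hNkj, Nat.add_sub_cancel_left]
  -- §4 The exponent vectors `mk k = (a₀ + k p, b₀ + (N - k) q)`.
  let mk : ℕ → (Fin 2 →₀ ℕ) := fun k =>
    Finsupp.single 0 (mmin 0 + k * p) + Finsupp.single 1 (mmax 1 + (N - k) * q)
  have hmk0 : ∀ k, mk k 0 = mmin 0 + k * p := by intro k; simp [mk]
  have hmk_eq : ∀ (m : Fin 2 →₀ ℕ) (k : ℕ), m 0 = mmin 0 + k * p →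
      m 1 = mmax 1 + (N - k) * q → m = mk k := by
    intro m k h0 h1
    ext j
    fin_cases j <;> simp [mk, h0, h1]
  have hmk_inj : ∀ k k', mk k = mk k' → k = k' := by
    intro k k' h
    have h' := DFunLike.congr_fun h 0
    rw [hmk0, hmk0] at h'
    exact Nat.eq_of_mul_eq_mul_right hp (by omega)
  have hmin_eq : mmin = mk 0 := hmk_eq mmin 0 (by simp) (by simpa using hN1)
  refine ⟨mmin 0, mmax 1, N, fun i => coeff (mk i) R, ?_, ?_⟩
  · -- `c₀ = coeff m_min R ≠ 0`
    show coeff (mk ((0 : Fin (N + 1)) : ℕ)) R ≠ 0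
    rw [Fin.val_zero, ← hmin_eq]
    exact mem_support_iff.mp hmin
  · -- §5 The identity, by comparing coefficients.
    have hterm : ∀ i : Fin (N + 1),
        X 0 ^ mmin 0 * X 1 ^ mmax 1 * (C (coeff (mk i) R) * ((X 0 ^ p) ^ (i : ℕ) *
          (X 1 ^ q) ^ (N - (i : ℕ)))) = monomial (mk i) (coeff (mk i) R) := by
      intro i
      have hi : mk i = Finsupp.single 0 (mmin 0 + i * p) +
          (Finsupp.single 1 (mmax 1 + (N - i) * q) + 0) := by rw [add_zero]
      rw [hi, monomial_single_add, monomial_single_add, ← C_apply]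
      ring
    rw [Finset.mul_sum, Finset.sum_congr rfl fun i _ => hterm i]
    ext m
    rw [coeff_sum]
    simp only [coeff_monomial]
    by_cases hm : ∃ i : Fin (N + 1), mk i = m
    · obtain ⟨i, rfl⟩ := hm
      rw [Finset.sum_eq_single i (fun j _ hji => if_neg fun h => hji
        (Fin.ext (hmk_inj _ _ h))) (fun h => absurd (Finset.mem_univ i) h), if_pos rfl]
    · push Not at hm
      rw [Finset.sum_eq_zero fun j _ => if_neg (hm j)]
      rw [← notMem_support_iff]
      intro hmS
      obtain ⟨k, hk, h0, h1⟩ := claim m hmS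
      exact hm ⟨k, Nat.lt_succ_of_le hk⟩ (hmk_eq m k h0 h1).symm

end Summit.ValiantsHypothesis.ValiantsHypothesis.Theorems.DivisionGap.PerCofactorDegreeReduction.WeightedLineNormalForm

end
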